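import Mathlib
import HarnessLib
import Literature.Analysis.FluidPDE.VectorCalculus
import Literature.Analysis.FluidPDE.VorticityCalculus

/-!
# `FilamentPinchDoor.FilamentPinchLiouville` (stmt-NavierStokesRegularity-26430) — line `birth` (LEAD skeleton r4,
# sha16 1889219810e22f2a): covariance and scale dependence of the TERMINAL windowed circulation (census Architecture II-3)

Helper next to the LEAD's `…FilamentPinchDoorFilamentPinchLiouvilleTerminalMass` (p623962: the terminal value
`T(φ,a,L) = lim_{t→0⁻} Ψ_L(a,t)` of every windowed circulation `Ψ_L(a,t) = L⁻¹∫⟪curl v(t,y),e⟫ φ(L⁻¹(y−a)) dy` EXISTS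
under the windowed Kelvin law, with rate `K₂(−s)/L²`).  Width seat ns-in-wu-con g2, DIRECTOR-NS dss_70/dss_71 (a);
census `pub/ns-inputs/kits/26430-pinchExclusion-census.md` §II.  Only what is NOT in p623962 is filed here:

* `tendsto_zero_iff_of_tendsto` / `noTerminalMass_iff_terminalFlux_eq_zero` — the conclusion of the open research stub
  `stub_noTerminalMass` for a triple `(φ,a,L)` is the statement `T(φ,a,L) = 0` (uniqueness of limits along `𝓝[<] 0`);
* `terminalFlux_nonneg_of_nonneg`, `abs_terminalFlux_le` — SIGN and SIZE: for `ω_e ≥ 0` and `φ ≥ 0` the terminal value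
  is `≥ 0`; under the landed window-mass bound (`stub_windowMass`, p620882) `|T| ≤ K₁`;
* `curl_comp_add_right`, `curl_comp_smul`, `integral_windowedFlux_translate`, `integral_windowedFlux_zoom` —
  TRANSLATION and NAVIER–STOKES-ZOOM covariance of the windowed circulation (slice by slice):
  `Ψ[v(·,·+b)]_L(a,t) = Ψ[v]_L(a+b,t)` and `Ψ[λv(λ²·,λ·)]_L(a,t) = Ψ[v]_{λL}(λa, λ²t)` (`λ > 0`; curl chain rule +
  `z = λy`), hence the same laws for `T`;
* `windowedFlux_le_two_mul` — SCALE DEPENDENCE: for `ω_e ≥ 0` and a window with `𝟙_{B₁} ≤ φ ≤ 𝟙_{B₂}`,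
  `Ψ_L ≤ 2Ψ_{2L}` pointwise in `(a,t)`, hence `T(φ,a,L) ≤ 2T(φ,a,2L)` (dyadic quasi-monotonicity of the terminal filament
  measure `μ₀`, `μ₀(B(a,L)) ≤ L·T(φ,a,L) ≤ μ₀(B(a,2L))`).

WHERE IT STOPS (census II-4; idea-crit-4 P-r3; DIRECTOR-NS dss_71: 26430 PARKED at the research stub): the
backward-singular-point hypothesis yields only LOWER bounds on scale-invariant quantities at PARABOLIC scales
`L ≍ √(−t)` (ε-regularity contrapositive, tree `Seregin2020CubicLowerBound.exists_le_cknC_of_isBackwardSingularPoint`); it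
does not speak to `T(φ,a,L)` at fixed `L`, which the regular far field dominates.  «singular point ⇒ T ≡ 0» is the
one-signed Type-I Liouville problem itself (open in print: Lei–Ren–Tian arXiv:2501.08976 Rem. 1.3; model enemy of
record: the terminal vorticity hedgehog `ω₀ = κ(x·e)x/|x|⁴`); nothing in this file is booked against it.

HONEST FRAMING: bookkeeping about HYPOTHETICAL Type-I blow-up profiles; nothing here bears on Navier–Stokes regularity;
no summit statement is proved; the open stub is untouched.
-/

noncomputable section

-- the summit and its single sub-problem share the name (CONVENTIONS §1), as in every Theorems file
set_option linter.dupNamespace false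

namespace Summit.NavierStokesRegularity.NavierStokesRegularity.Theorems.FilamentPinchDoorFilamentPinchLiouvilleFarFieldFlux

open Set Function Filter MeasureTheory Metric Topology InnerProductSpace
open scoped ENNReal NNReal RealInnerProductSpace
open Literature.Analysis Literature.Analysis.FluidPDE

/-! ### The terminal value: restatement of the open stub, sign and size -/

/-- If `Ψ → Φ` as `t → 0⁻`, then `Ψ → 0` as `t → 0⁻` iff `Φ = 0` (uniqueness of limits along the non-trivial filter
`𝓝[<] 0`). [folklore] -/
theorem tendsto_zero_iff_of_tendsto {Ψ : ℝ → ℝ} {Φ : ℝ} (h : Tendsto Ψ (𝓝[<] (0 : ℝ)) (𝓝 Φ)) :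
    Tendsto Ψ (𝓝[<] (0 : ℝ)) (𝓝 0) ↔ Φ = 0 := by
  constructor
  · intro h0
    exact tendsto_nhds_unique h h0
  · rintro rfl
    exact h

/-- **No terminal mass, restated.** For a window/centre/scale with terminal flux `Φ`, the conclusion of
`stub_noTerminalMass` for that triple is equivalent to `Φ = 0`. [folklore] -/
theorem noTerminalMass_iff_terminalFlux_eq_zero {v : ℝ → (EuclideanSpace ℝ (Fin 3)) → (EuclideanSpace ℝ (Fin 3))} {e : (EuclideanSpace ℝ (Fin 3))} {φ : (EuclideanSpace ℝ (Fin 3)) → ℝ} {a : (EuclideanSpace ℝ (Fin 3))}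
    {L Φ : ℝ}
    (hΦ : Tendsto (fun t : ℝ => L⁻¹ * ∫ y, ⟪curl (v t) y, e⟫_ℝ * φ (L⁻¹ • (y - a))) (𝓝[<] (0 : ℝ)) (𝓝 Φ)) :
    Tendsto (fun t : ℝ => L⁻¹ * ∫ y, ⟪curl (v t) y, e⟫_ℝ * φ (L⁻¹ • (y - a))) (𝓝[<] (0 : ℝ)) (𝓝 0) ↔
      Φ = 0 :=
  tendsto_zero_iff_of_tendsto hΦ

/-- **Sign of the terminal flux.** If `ω_e ≥ 0` on every slice and the window is non-negative, the terminal flux is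
`≥ 0` (`L > 0`). [folklore] -/
theorem terminalFlux_nonneg_of_nonneg {v : ℝ → (EuclideanSpace ℝ (Fin 3)) → (EuclideanSpace ℝ (Fin 3))} {e : (EuclideanSpace ℝ (Fin 3))} {φ : (EuclideanSpace ℝ (Fin 3)) → ℝ} {a : (EuclideanSpace ℝ (Fin 3))} {L Φ : ℝ}
    (hL : 0 < L) (hnn : ∀ s < 0, ∀ y, 0 ≤ ⟪curl (v s) y, e⟫_ℝ) (hφ0 : ∀ z, 0 ≤ φ z)
    (hΦ : Tendsto (fun t : ℝ => L⁻¹ * ∫ y, ⟪curl (v t) y, e⟫_ℝ * φ (L⁻¹ • (y - a))) (𝓝[<] (0 : ℝ)) (𝓝 Φ)) :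
    0 ≤ Φ := by
  refine ge_of_tendsto hΦ ?_
  filter_upwards [self_mem_nhdsWithin] with t ht
  exact mul_nonneg (inv_nonneg.2 hL.le)
    (integral_nonneg fun y => mul_nonneg (hnn t ht y) (hφ0 _))

/-- **Size of the terminal flux.** Under the landed window-mass bound (`stub_windowMass`, p620882: `|Ψ_L(a,s)| ≤ K₁`
for all `L > 0`, `a`, `s < 0`), the terminal flux satisfies `|Φ| ≤ K₁`. [folklore] -/
theorem abs_terminalFlux_le {v : ℝ → (EuclideanSpace ℝ (Fin 3)) → (EuclideanSpace ℝ (Fin 3))} {e : (EuclideanSpace ℝ (Fin 3))} {φ : (EuclideanSpace ℝ (Fin 3)) → ℝ} {a : (EuclideanSpace ℝ (Fin 3))} {L Φ K₁ : ℝ}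
    (hK₁ : ∀ s < 0, |L⁻¹ * ∫ y, ⟪curl (v s) y, e⟫_ℝ * φ (L⁻¹ • (y - a))| ≤ K₁)
    (hΦ : Tendsto (fun t : ℝ => L⁻¹ * ∫ y, ⟪curl (v t) y, e⟫_ℝ * φ (L⁻¹ • (y - a))) (𝓝[<] (0 : ℝ)) (𝓝 Φ)) :
    |Φ| ≤ K₁ := by
  have h := (continuous_abs.tendsto Φ).comp hΦ
  refine le_of_tendsto h ?_
  filter_upwards [self_mem_nhdsWithin] with t ht
  exact hK₁ t ht

/-! ### Covariance and scale dependence of the windowed flux -/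

/-- The curl of a translate: `curl (w(· + b))(y) = curl w (y + b)`. [folklore] -/
theorem curl_comp_add_right (w : (EuclideanSpace ℝ (Fin 3)) → (EuclideanSpace ℝ (Fin 3))) (b y : (EuclideanSpace ℝ (Fin 3))) :
    curl (fun x => w (x + b)) y = curl w (y + b) := by
  rw [curl_eq_curlCLM, curl_eq_curlCLM, fderiv_comp_add_right]

/-- The curl of a dilate: `curl (w(c ·))(y) = c • curl w (c y)`. [folklore] -/
theorem curl_comp_smul (w : (EuclideanSpace ℝ (Fin 3)) → (EuclideanSpace ℝ (Fin 3))) (c : ℝ) (y : (EuclideanSpace ℝ (Fin 3))) :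
    curl (fun x => w (c • x)) y = c • curl w (c • y) := by
  rw [curl_eq_curlCLM, curl_eq_curlCLM, fderiv_comp_smul, map_smul]

/-- **Translation covariance of the windowed flux**: `Ψ[v(·,· + b)]_L(a,t) = Ψ[v]_L(a + b, t)` (one slice `w = v(t)`).
[folklore] -/
theorem integral_windowedFlux_translate (w : (EuclideanSpace ℝ (Fin 3)) → (EuclideanSpace ℝ (Fin 3))) (e : (EuclideanSpace ℝ (Fin 3))) (φ : (EuclideanSpace ℝ (Fin 3)) → ℝ) (L : ℝ) (a b : (EuclideanSpace ℝ (Fin 3))) :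
    ∫ y, ⟪curl (fun x => w (x + b)) y, e⟫_ℝ * φ (L⁻¹ • (y - a)) =
      ∫ y, ⟪curl w y, e⟫_ℝ * φ (L⁻¹ • (y - (a + b))) := by
  simp_rw [curl_comp_add_right]
  have h := integral_add_right_eq_self (μ := (volume : Measure (EuclideanSpace ℝ (Fin 3))))
    (fun y => ⟪curl w y, e⟫_ℝ * φ (L⁻¹ • (y - (a + b)))) b
  rw [← h]
  refine integral_congr_ae (Eventually.of_forall fun y => ?_)
  simp only [add_sub_add_right_eq_sub]

/-- **Zoom covariance of the windowed flux** (Navier–Stokes scaling `v ↦ λ v(λ²t, λx)`, one slice `w = v(λ²t)`,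
`w` differentiable): `L⁻¹ ∫ ⟪curl (λ w(λ·))(y), e⟫ φ(L⁻¹(y − a)) dy = (λL)⁻¹ ∫ ⟪curl w(z), e⟫ φ((λL)⁻¹(z − λa)) dz`
(`λ > 0`; curl chain rule and the change of variables `z = λy` in `ℝ³`). [folklore] -/
theorem integral_windowedFlux_zoom {w : (EuclideanSpace ℝ (Fin 3)) → (EuclideanSpace ℝ (Fin 3))} (hw : Differentiable ℝ w) (e : (EuclideanSpace ℝ (Fin 3))) (φ : (EuclideanSpace ℝ (Fin 3)) → ℝ) (L : ℝ) (a : (EuclideanSpace ℝ (Fin 3)))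
    {c : ℝ} (hc : 0 < c) :
    L⁻¹ * ∫ y, ⟪curl (fun x => c • w (c • x)) y, e⟫_ℝ * φ (L⁻¹ • (y - a)) =
      (c * L)⁻¹ * ∫ z, ⟪curl w z, e⟫_ℝ * φ ((c * L)⁻¹ • (z - c • a)) := by
  -- the curl of the zoomed slice
  have hcurl : ∀ y, curl (fun x => c • w (c • x)) y = c • (c • curl w (c • y)) := by
    intro y
    have hd : DifferentiableAt ℝ (fun x => w (c • x)) y := (hw _).comp y (differentiableAt_id.const_smul c)
    rw [curl_const_smul hd, curl_comp_smul]
  simp_rw [hcurl, inner_smul_left, RCLike.conj_to_real]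
  -- rewrite the window in the variable `z = c • y`
  have hc0 : c ≠ 0 := hc.ne'
  have hwin : ∀ y : (EuclideanSpace ℝ (Fin 3)), φ (L⁻¹ • (y - a)) = φ ((c * L)⁻¹ • (c • y - c • a)) := by
    intro y
    rw [← smul_sub, smul_smul]
    congr 2
    field_simp
  simp_rw [hwin]
  -- change of variables `z = c • y`: `∫ f(c y) dy = c⁻³ ∫ f(z) dz`
  have hcov := Measure.integral_comp_smul (μ := (volume : Measure (EuclideanSpace ℝ (Fin 3))))
    (fun z => ⟪curl w z, e⟫_ℝ * φ ((c * L)⁻¹ • (z - c • a))) c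
  have h3 : Module.finrank ℝ (EuclideanSpace ℝ (Fin 3)) = 3 := by simp
  rw [h3] at hcov
  have hrw : (fun y : (EuclideanSpace ℝ (Fin 3)) => c * (c * ⟪curl w (c • y), e⟫_ℝ) * φ ((c * L)⁻¹ • (c • y - c • a))) =
      fun y => c ^ 2 * ((fun z => ⟪curl w z, e⟫_ℝ * φ ((c * L)⁻¹ • (z - c • a))) (c • y)) := by
    funext y; ring
  rw [hrw, integral_const_mul, hcov, smul_eq_mul, abs_of_pos (inv_pos.2 (pow_pos hc 3))]
  field_simp

/-- **Dyadic control of the scale dependence.**  For a non-negative continuous density `ω` and a window with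
`𝟙_{B(0,1)} ≤ φ ≤ 𝟙_{B(0,2)}` (continuous, `0 ≤ φ ≤ 1`, `φ = 1` on the closed unit ball, `φ = 0` outside `B(0,2)`):
`L⁻¹∫ ω φ(L⁻¹(y−a)) ≤ 2 · (2L)⁻¹ ∫ ω φ((2L)⁻¹(y−a))` (`L > 0`), since `φ_L ≤ φ_{2L}` pointwise. [folklore] -/
theorem windowedFlux_le_two_mul {ω φ : (EuclideanSpace ℝ (Fin 3)) → ℝ} (hωc : Continuous ω) (hω0 : ∀ y, 0 ≤ ω y) (hφc : Continuous φ)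
    (hφ0 : ∀ z, 0 ≤ φ z) (hφ1 : ∀ z, φ z ≤ 1) (hφone : ∀ z, ‖z‖ ≤ 1 → φ z = 1)
    (hφsupp : ∀ z, 2 ≤ ‖z‖ → φ z = 0) {L : ℝ} (hL : 0 < L) (a : (EuclideanSpace ℝ (Fin 3))) :
    L⁻¹ * ∫ y, ω y * φ (L⁻¹ • (y - a)) ≤ 2 * ((2 * L)⁻¹ * ∫ y, ω y * φ ((2 * L)⁻¹ • (y - a))) := by
  have h2L : 0 < 2 * L := by positivity
  -- pointwise comparison of the two windows
  have hpt : ∀ y, φ (L⁻¹ • (y - a)) ≤ φ ((2 * L)⁻¹ • (y - a)) := by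
    intro y
    have hn1 : ‖L⁻¹ • (y - a)‖ = L⁻¹ * ‖y - a‖ := by
      rw [norm_smul, norm_inv, Real.norm_of_nonneg hL.le]
    have hn2 : ‖(2 * L)⁻¹ • (y - a)‖ = (2 * L)⁻¹ * ‖y - a‖ := by
      rw [norm_smul, norm_inv, Real.norm_of_nonneg h2L.le]
    rcases lt_or_ge (‖y - a‖) (2 * L) with hy | hy
    · have hle : ‖(2 * L)⁻¹ • (y - a)‖ ≤ 1 := by
        rw [hn2, inv_mul_le_iff₀ h2L]
        linarith
      rw [hφone _ hle]
      exact hφ1 _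
    · have hge : 2 ≤ ‖L⁻¹ • (y - a)‖ := by
        rw [hn1, le_inv_mul_iff₀' hL]
        linarith
      rw [hφsupp _ hge]
      exact hφ0 _
  -- the larger integrand is integrable (continuous with compact support)
  have hsupp2 : HasCompactSupport fun y : (EuclideanSpace ℝ (Fin 3)) => ω y * φ ((2 * L)⁻¹ • (y - a)) := by
    refine HasCompactSupport.intro (isCompact_closedBall a (2 * (2 * L))) fun y hy => ?_
    rw [mem_closedBall, dist_eq_norm, not_le] at hy
    have hge : 2 ≤ ‖(2 * L)⁻¹ • (y - a)‖ := by
      rw [norm_smul, norm_inv, Real.norm_of_nonneg h2L.le, le_inv_mul_iff₀' h2L]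
      linarith
    show ω y * φ ((2 * L)⁻¹ • (y - a)) = 0
    rw [hφsupp _ hge, mul_zero]
  have hcont2 : Continuous fun y : (EuclideanSpace ℝ (Fin 3)) => ω y * φ ((2 * L)⁻¹ • (y - a)) :=
    hωc.mul (hφc.comp ((continuous_id.sub continuous_const).const_smul ((2 * L)⁻¹)))
  have hint2 : Integrable (fun y : (EuclideanSpace ℝ (Fin 3)) => ω y * φ ((2 * L)⁻¹ • (y - a))) :=
    hcont2.integrable_of_hasCompactSupport hsupp2
  have hmono : ∫ y, ω y * φ (L⁻¹ • (y - a)) ≤ ∫ y, ω y * φ ((2 * L)⁻¹ • (y - a)) :=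
    integral_mono_of_nonneg (Eventually.of_forall fun y => mul_nonneg (hω0 y) (hφ0 _)) hint2
      (Eventually.of_forall fun y => mul_le_mul_of_nonneg_left (hpt y) (hω0 y))
  calc L⁻¹ * ∫ y, ω y * φ (L⁻¹ • (y - a)) ≤ L⁻¹ * ∫ y, ω y * φ ((2 * L)⁻¹ • (y - a)) :=
        mul_le_mul_of_nonneg_left hmono (inv_nonneg.2 hL.le)
    _ = 2 * ((2 * L)⁻¹ * ∫ y, ω y * φ ((2 * L)⁻¹ • (y - a))) := by
        rw [mul_inv, ← mul_assoc, ← mul_assoc, mul_inv_cancel₀ (two_ne_zero), one_mul]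

end Summit.NavierStokesRegularity.NavierStokesRegularity.Theorems.FilamentPinchDoorFilamentPinchLiouvilleFarFieldFlux

end
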